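import Summits.ResolutionOfSingularities.ResolutionOfSingularities.Theorems.WeightedInvariantIota3TauDescentBaseTwo
import Summits.ResolutionOfSingularities.ResolutionOfSingularities.Theorems.WeightedInvariantIota3TauDescentBaseTwoLexMax
import Summits.ResolutionOfSingularities.ResolutionOfSingularities.Theorems.WeightedInvariantTiePresentationTransfer
import Summits.ResolutionOfSingularities.ResolutionOfSingularities.Theorems.WeightedInvariantAQSBaseChangeDescent
import HarnessLib

/-!
# (desc-τ), CASE A′: A TIE OVER A BASE OF DIMENSION TWO PLAYS THE BASE'S OWN ABRAMOVICH–QUEK–SCHOBER MOVE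
# (door `HypersurfaceCentreConstruction`, stmt-ResolutionOfSingularities-19897; registered stub `stub_keyRungGrHomLE_three`, gap (1) (desc-τ))

Topic: `Summits/ResolutionOfSingularities/ResolutionOfSingularities/Theorems`. Helper for the door item `HypersurfaceCentreConstruction`
(stmt-ResolutionOfSingularities-19897, route `WeightedInvariant`), line `local-engine`, def-free.  Third brick of the flat-pullback argument for case
(A′) «no tie position over a base of dimension two» of (desc-τ) (…Iota3TauDescentLowDim `isTiePosition_descent_of_cases`, …Iota3TauDescentBaseTwo
`isTiePosition_descent_of_cases'`, …Iota3TauDescentBaseTwoLexMax):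

* **`Iota3.IsTiePresentation.weights_eq_of_base`** — `φ : T → T'` local, formally smooth, essentially of finite type between regular local rings,
  `dim T = 2`, `dim T' = 3`; `(x, y, z; q, r; λ)` a tie presentation of `(T', φ g)` whose plane is the closed-fibre ideal, `(x, y) = 𝔪_T T'`
  (the only possible ones, …Iota3TauDescentBaseTwo); `(t, s; w; ℓ)` the lex-maximal admissible weighted centre germ of `(g) ⊆ T`
  (Abramovich–Quek–Schober Thm 3.5; for `T` essentially of finite type over a field it exists by `AQSHeightTwo.exists_isLexMaxWeightedCentreGerm`,
  existence over an arbitrary two-dimensional regular local ring is not yet in the tree).  Then `w = (r, q)`, `ℓ = r·ν` (`ν` the order of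
  `g` and of `φ g`), and the presentation's weighted filtration IS THE EXTENSION OF THE BASE'S:
  `𝒥ₙ((y, x); (r, q)) = 𝒥ₙ((t, s); (r, q))·T'` for every `n` — by the ascent of the datum to `T'_{𝔪_T T'}`
  (`isLexMaxWeightedCentreGerm_map_atPrime_of_eq_map_maximalIdeal`) and Abramovich–Quek–Schober uniqueness contracted to `T'`
  (`IsTiePresentation.weightedMonomialIdeal_eq_of_isLexMax`).

So the cylinder move of a case-(A′) tie is the base change along `φ` of the POINT move of the plane curve germ `(T, g)` at its lex-maximal centre;
what remains of (A′) is to pull the no-drop successor over `𝔪_{T'}` (…TieNoDropSuccessor) back along that flat base change and contradict the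
two-dimensional order drop `LexMaxOrderDrop.adicOrder_transform_lt_of_isLexMax`.

[OURS · L1 W4.3 · (desc-τ) case A′, brick 3]  Replaces the role of NO printed item; NOT a statement of the manuscript under review
[claim: Hironaka2017, status: under-review]; candidates stay candidates; AI work, weaker than expert review.  No definition; no axiom.

## References

* D. Abramovich, M. H. Quek, B. Schober, arXiv:2507.01232 (2025), Thm 3.5 («well-defined, unique»; stability under separable base change).
  [AbramovichQuekSchober2025]
* H. Matsumura, *Commutative Ring Theory* (1986), Thm. 14.2, Thm. 15.1. [Matsumura1987]
-/

noncomputable section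

set_option linter.dupNamespace false -- mandated namespace `Summit.<Summit>.<Problem>` of this single-conjunct summit

open IsLocalRing Literature.AlgebraicGeometry.Resolution
open Summit.ResolutionOfSingularities.ResolutionOfSingularities.Theorems
open Summit.ResolutionOfSingularities.ResolutionOfSingularities.Theorems.ContactCylinder

namespace Summit.ResolutionOfSingularities.ResolutionOfSingularities.Cruxes.HypersurfaceCentreConstruction.LocalEngine

namespace Iota3

section Transfer

variable (T T' : Type) [CommRing T] [CommRing T'] [IsRegularLocalRing T] [IsRegularLocalRing T'] [Algebra T T']
  [IsLocalHom (algebraMap T T')] [Algebra.FormallySmooth T T'] [Algebra.EssFiniteType T T']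

/-- `span {a, b, c} = span {a, b} ⊔ span {c}`. [folklore] -/
theorem span_triple_eq_sup {R : Type} [CommRing R] (a b c : R) :
    Ideal.span ({a, b, c} : Set R) = Ideal.span {a, b} ⊔ Ideal.span {c} := by
  rw [show ({a, b, c} : Set R) = {a, b} ∪ {c} by
    ext t; simp only [Set.mem_insert_iff, Set.mem_singleton_iff, Set.mem_union]; tauto, Ideal.span_union]

omit [IsLocalHom (algebraMap T T')] in
/-- **A CASE-(A′) TIE PRESENTATION CARRIES THE BASE'S WEIGHTS AND FILTRATION.**  See the module docstring.
[cite: AbramovichQuekSchober2025, Thm 3.5] -/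
theorem IsTiePresentation.weights_eq_of_base (hdimT : ringKrullDim T = (2 : ℕ)) (hdimT' : ringKrullDim T' = (3 : ℕ))
    {g : T} {x y z : T'} {q r : ℕ} {lam : T'} (h : IsTiePresentation T' (algebraMap T T' g) x y z q r lam)
    (hxy : Ideal.span {x, y} = (maximalIdeal T).map (algebraMap T T'))
    {t s : T} {w : Fin 2 → ℕ} {ℓ : ℕ} (hlex : IsLexMaxWeightedCentreGerm T (Ideal.span {g}) ![t, s] w ℓ)
    {ν : ℕ} (hfν : algebraMap T T' g ∈ maximalIdeal T' ^ ν) (hfν1 : algebraMap T T' g ∉ maximalIdeal T' ^ (ν + 1)) :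
    w = ![r, q] ∧ ℓ = r * ν ∧
      ∀ n, weightedMonomialIdeal ![y, x] ![r, q] n = (weightedMonomialIdeal ![t, s] ![r, q] n).map (algebraMap T T') := by
  classical
  have hdim3 : ringKrullDim T' = 3 := by rw [hdimT']; rfl
  -- the plane of the presentation: `(x, y) = 𝔪_T T' = (φ t, φ s)`
  have hts : Ideal.span (Set.range ![t, s]) = maximalIdeal T := hlex.1
  have hts' : Ideal.span ({t, s} : Set T) = maximalIdeal T := by
    rw [← hts, Matrix.range_cons, Matrix.range_cons, Matrix.range_empty, Set.union_empty, Set.singleton_union]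
  have hP'ts : (maximalIdeal T).map (algebraMap T T') = Ideal.span {algebraMap T T' t, algebraMap T T' s} := by
    rw [← hts', Ideal.map_span, Set.image_pair]
  haveI hPxy : (Ideal.span ({x, y} : Set T')).IsPrime := by obtain ⟨-, -, -, hP, -⟩ := h; exact hP
  have hP₀ : topStratumPrime iotaOrdEps T' (algebraMap T T' g) = Ideal.span {x, y} := h.2.1
  -- the datum of the base ascends to `T'_{(x, y)}`
  have hup := isLexMaxWeightedCentreGerm_map_atPrime_of_eq_map_maximalIdeal T T' hdimT (Ideal.span ({x, y} : Set T')) hxy hlex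
  have hfun : (fun i => algebraMap T' (Localization.AtPrime (Ideal.span ({x, y} : Set T'))) (algebraMap T T' ((![t, s] : Fin 2 → T) i))) =
      fun i => algebraMap T' (Localization.AtPrime (Ideal.span ({x, y} : Set T')))
        ((![algebraMap T T' t, algebraMap T T' s] : Fin 2 → T') i) := by
    funext i; fin_cases i <;> rfl
  rw [hfun] at hup
  -- the pushed pair is cotangent independent and lies in the plane
  have hu : ∀ i, (![algebraMap T T' t, algebraMap T T' s] : Fin 2 → T') i ∈ maximalIdeal T' := by
    have hyxz : Ideal.span (Set.range ![algebraMap T T' t, algebraMap T T' s, z]) = maximalIdeal T' := by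
      rw [Matrix.range_cons, Matrix.range_cons, Matrix.range_cons, Matrix.range_empty, Set.union_empty, Set.singleton_union,
        Set.singleton_union, span_triple_eq_sup, ← hP'ts, ← hxy, ← span_triple_eq_sup, h.1]
    exact LocalGameEFTCylinder.mem_maximalIdeal_pair hyxz
  have hyxz : Ideal.span (Set.range ![algebraMap T T' t, algebraMap T T' s, z]) = maximalIdeal T' := by
    rw [Matrix.range_cons, Matrix.range_cons, Matrix.range_cons, Matrix.range_empty, Set.union_empty, Set.singleton_union,
      Set.singleton_union, span_triple_eq_sup, ← hP'ts, ← hxy, ← span_triple_eq_sup, h.1]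
  have hli := LocalGameEFTCylinder.linearIndependent_toCotangent_pair hyxz (spanFinrank_eq_three_of_ringKrullDim hdim3)
  have huP : ∀ i, (![algebraMap T T' t, algebraMap T T' s] : Fin 2 → T') i ∈ Ideal.span ({x, y} : Set T') := by
    intro i
    rw [hxy, hP'ts]
    fin_cases i
    · exact Ideal.subset_span (Set.mem_insert _ _)
    · exact Ideal.subset_span (Set.mem_insert_of_mem _ (Set.mem_singleton _))
  -- Abramovich–Quek–Schober uniqueness, contracted to `T'`
  obtain ⟨hw, hℓ, hfil⟩ := h.weightedMonomialIdeal_eq_of_isLexMax hdim3 hfν hfν1 (Ideal.span ({x, y} : Set T')) hP₀ hu hli huP hup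
  refine ⟨hw, hℓ, fun n => ?_⟩
  rw [AQSBaseChange.map_weightedMonomialIdeal_two, ← hfil n, hw]

end Transfer

end Iota3

end Summit.ResolutionOfSingularities.ResolutionOfSingularities.Cruxes.HypersurfaceCentreConstruction.LocalEngine

end
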